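import Summits.QuantumFields.YangMills.Theorems.BalabanLadderUVSeamRecCeilingsPolymerRarityPlaquetteScale
import HarnessLib

/-!
# Crux `UVSeamRec` (stmt-QuantumFields-20043), stub `stub_ceilings` (E0′): the scale-zero LARGE-FIELD POLYMER GAS of the
# Wilson state on every odd torus — connected large-field regions obey the Peierls product law for ALL sub-families

Helper file (`--supports stmt-QuantumFields-20043`) of the width-lever seat `ym-20043-ceilings-p2` (lane B, gen 2); sequel
of p530009 `…CeilingsPolymerRarityPlaquetteScale.lean` (`productLaw_largePlaquettes`: the ε-large PLAQUETTES of the Wilson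
state on an odd four-torus form a Peierls gas of activity `δ(β,ε) = exp(−βε/m + (K₀ + D₁ log β)/m)`).  HONEST FRAMING:
unconditional theorems, but at the PLAQUETTE scale (k = 0) only — the multiscale analogue for Bałaban's block-averaged
large-field regions, which the large-field carrier of the v5(α)/(β) architecture needs (`…CeilingsResponseCarriers`,
`responseMoments_of_quadratic_and_polymerLaw`), is OPEN on odd tori; nothing of E0′; not a gap, not Clay.

WHY.  The product law (PL)(iv) consumed by p527372 `integral_exp_sum_indicator_le_prod` / p528131 `rarity_of_polymerLaw` is
asked for EVERY sub-family `A ⊆ S` of polymer events, `μ(⋂_{γ∈A} E_γ) ≤ ∏_{γ∈A} w_γ`.  For the naive events «all plaquettes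
of `γ` are large» this FAILS for overlapping polymers (the intersection is the event of the UNION, whose weight
`δ^{#(γ∪γ')}` exceeds `δ^{#γ}δ^{#γ'}`); p529130 `productLaw_of_compatible` therefore asked it only of compatible families.
The genuine polymer gas of a large-field REGION repairs this with no loss: index the gas by the CONNECTED COMPONENTS of
the region — the event `E_γ` := «`γ` is a maximal connected ε-large set: every plaquette of `γ` is ε-large and every
plaquette adjacent to `γ` outside `γ` is not».  Two distinct components never overlap, so for an INCOMPATIBLE
(overlapping) family the intersection is EMPTY, and for a compatible (pairwise disjoint) family it is contained in «all
plaquettes of `⋃γ` are large», whose probability p530009 bounds by `δ^{Σ#γ} = ∏ δ^{#γ}`.  Hence the component gas obeys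
the product law for ALL sub-families with the Bałaban-kind weights `w_γ = δ(β,ε)^{#γ}` («density `e^{−cβ|γ|}`»), on every
odd torus, primes included — the scale-zero instance of the R-operation's large-field region expansion.

* §1 (combinatorics, any type) `inter_eq_empty_of_cutConnected` — component events of two distinct overlapping
  CUT-CONNECTED polymers are disjoint («cut-connected»: every nontrivial 2-partition of `γ` is crossed by an adjacency —
  the cut characterisation of connectedness; ANY adjacency relation is allowed).
* §2 (measure theory, any finite measure) `productLaw_of_exclusive` — a cell product law `μ(⋂_{p∈A} Bad_p) ≤ ∏ δ_p` plus
  events `E_γ ⊆ ⋂_{p∈supp γ} Bad_p` that are mutually exclusive on support-overlaps give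
  `μ(⋂_{γ∈A} E_γ) ≤ ∏_{γ∈A} ∏_{p∈supp γ} δ_p` for EVERY finite family `A`; `productLaw_of_components` (supports = the
  polymers themselves, exclusivity from §1).
* §3 (Wilson state, every odd torus `M ≥ 3`, `β ≥ 1`) **`productLaw_largePlaquetteComponents`** — for every adjacency on
  torus plaquettes and every family of cut-connected polymers, the component events satisfy
  `μ_{M,β}(⋂_{γ∈A} E_γ) ≤ ∏_{γ∈A} δ(β,ε)^{#γ}` for all `A`; **`torusE_prod_indicator_largeComponentZd_le`** — the same in
  the LIFTED vocabulary of the route (polymers = finite sets of plaquettes of `ℤ⁴` based in the fundamental box, events on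
  `LGConfig 4 G`, clause (PL)(iv) of `rarity_of_polymerLaw` / `responseMoments_of_quadratic_and_polymerLaw` verbatim).

The remaining (PL) bookkeeping for this gas — the density budget `Σ_{γ∋p} c_γ δ^{#γ} ≤ W` — is the lattice-animal count
(at most `(2eΔ)^s` connected sets of size `s` through a given cell in a graph of degree `Δ`; Klarner 1967 / Eden 1961),
not proved here.

References: folklore (cut characterisation of connectedness; Peierls/polymer bookkeeping as in D. Brydges, *A short
course on cluster expansions*, Les Houches 1984, §2, and R. Kotecký, D. Preiss, Commun. Math. Phys. 103 (1986) 491–498);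
the scale-zero input is Fröhlich–Israel–Lieb–Simon, Commun. Math. Phys. 62 (1978) §5 via p530009; the intended multiscale
analogue is T. Bałaban, Commun. Math. Phys. 122 (1989) 355–392, (1.79)–(1.89).
-/

set_option autoImplicit false

noncomputable section

open MeasureTheory Filter Topology Finset
open Literature.Probability.LatticeModels
open Literature.MathematicalPhysics.QuantumFieldTheory (GaugeConfig wilsonMeasure isProbabilityMeasure_wilsonMeasure
  measurable_torusLift LatticeRep Plaquette plaquetteCost measurable_plaquetteCost)
open Literature.MathematicalPhysics.QuantumLattice
open Summit.QuantumFields.YangMills.Cruxes.UVSeamRec.DefectCollar (integral_prod_indicator_eq_measureReal)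
open Summit.QuantumFields.YangMills.Theorems.OddTorusChessboard (Orient)

namespace Summit.QuantumFields.YangMills.Cruxes.UVSeamRec.PolymerRarity

/-! ## §1 Combinatorics: component events of distinct overlapping cut-connected polymers are disjoint -/

section Combinatorics

variable {Ω P : Type*} [DecidableEq P]

/-- **Exclusivity of component events.**  Let `adj` be ANY relation on cells, `Bad p ⊆ Ω` the «cell `p` is large» events,
and for polymers `γ` (finite sets of cells) let `E γ ⊆ Ω` satisfy (E1) `E γ ⊆ ⋂_{p∈γ} Bad p` and (E2) «the boundary is
clean»: for `u ∈ γ`, `v ∉ γ` with `adj u v`, `E γ ∩ Bad v = ∅`.  If `γ` and `γ'` are CUT-CONNECTED (every splitting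
`γ = A ⊔ (γ∖A)` into nonempty parts has `u ∈ A`, `v ∈ γ∖A` with `adj u v`), distinct and NOT disjoint, then
`E γ ∩ E γ' = ∅`.  Proof: one of them, say `γ'`, is not contained in the other; split `γ'` into `γ' ∩ γ` (nonempty: they
overlap) and `γ' ∖ γ` (nonempty); a crossing adjacency `u → v` has `u ∈ γ`, `v ∉ γ`, `v ∈ γ'`, so on `E γ` the cell `v`
is clean while on `E γ'` it is large. [folklore] -/
theorem inter_eq_empty_of_cutConnected (adj : P → P → Prop) (Bad : P → Set Ω) (E : Finset P → Set Ω)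
    {γ γ' : Finset P}
    (hconn : ∀ A ⊆ γ, A.Nonempty → (γ \ A).Nonempty → ∃ u ∈ A, ∃ v ∈ γ \ A, adj u v)
    (hconn' : ∀ A ⊆ γ', A.Nonempty → (γ' \ A).Nonempty → ∃ u ∈ A, ∃ v ∈ γ' \ A, adj u v)
    (hE1 : E γ ⊆ ⋂ p ∈ γ, Bad p) (hE1' : E γ' ⊆ ⋂ p ∈ γ', Bad p)
    (hE2 : ∀ u ∈ γ, ∀ v ∉ γ, adj u v → E γ ∩ Bad v = ∅)
    (hE2' : ∀ u ∈ γ', ∀ v ∉ γ', adj u v → E γ' ∩ Bad v = ∅)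
    (hne : γ ≠ γ') (hov : ¬ Disjoint γ γ') : E γ ∩ E γ' = ∅ := by
  obtain ⟨p, hp, hp'⟩ := Finset.not_disjoint_iff.1 hov
  by_cases hsub : γ' ⊆ γ
  · -- then `γ ⊄ γ'`: split `γ` into `γ ∩ γ'` and `γ ∖ γ'`
    have hns : ¬ γ ⊆ γ' := fun h => hne (Finset.Subset.antisymm h hsub)
    obtain ⟨q, hq, hq'⟩ := Finset.not_subset.1 hns
    obtain ⟨u, hu, v, hv, huv⟩ := hconn (γ ∩ γ') Finset.inter_subset_left ⟨p, Finset.mem_inter.2 ⟨hp, hp'⟩⟩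
      ⟨q, Finset.mem_sdiff.2 ⟨hq, fun h => hq' (Finset.mem_inter.1 h).2⟩⟩
    have hvγ : v ∈ γ := (Finset.mem_sdiff.1 hv).1
    have hvγ' : v ∉ γ' := fun h => (Finset.mem_sdiff.1 hv).2 (Finset.mem_inter.2 ⟨hvγ, h⟩)
    have huγ' : u ∈ γ' := (Finset.mem_inter.1 hu).2
    have h1 : E γ ⊆ Bad v := fun ω hω => Set.mem_iInter₂.1 (hE1 hω) v hvγ
    have h2 : E γ' ∩ Bad v = ∅ := hE2' u huγ' v hvγ' huv
    rw [Set.eq_empty_iff_forall_notMem] at h2 ⊢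
    exact fun ω hω => h2 ω ⟨hω.2, h1 hω.1⟩
  · -- `γ' ⊄ γ`: split `γ'` into `γ' ∩ γ` and `γ' ∖ γ`
    obtain ⟨q, hq, hq'⟩ := Finset.not_subset.1 hsub
    obtain ⟨u, hu, v, hv, huv⟩ := hconn' (γ' ∩ γ) Finset.inter_subset_left ⟨p, Finset.mem_inter.2 ⟨hp', hp⟩⟩
      ⟨q, Finset.mem_sdiff.2 ⟨hq, fun h => hq' (Finset.mem_inter.1 h).2⟩⟩
    have hvγ' : v ∈ γ' := (Finset.mem_sdiff.1 hv).1
    have hvγ : v ∉ γ := fun h => (Finset.mem_sdiff.1 hv).2 (Finset.mem_inter.2 ⟨hvγ', h⟩)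
    have huγ : u ∈ γ := (Finset.mem_inter.1 hu).2
    have h1 : E γ' ⊆ Bad v := fun ω hω => Set.mem_iInter₂.1 (hE1' hω) v hvγ'
    have h2 : E γ ∩ Bad v = ∅ := hE2 u huγ v hvγ huv
    rw [Set.eq_empty_iff_forall_notMem] at h2 ⊢
    exact fun ω hω => h2 ω ⟨hω.1, h1 hω.2⟩

omit [DecidableEq P] in
/-- **The canonical component events satisfy (E1), (E2).**  For thresholded cells («`Bad p = {t ≤ φ_p}`») the event
`{ω | (∀ p ∈ γ, t ≤ φ_p ω) ∧ (∀ u ∈ γ, ∀ v, adj u v → v ∉ γ → φ_v ω < t)}` («`γ` is an ε-large component») is contained in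
`⋂_{p∈γ} {t ≤ φ_p}` and meets no `{t ≤ φ_v}` across its boundary. [folklore] -/
theorem componentEvent_spec (adj : P → P → Prop) (φ : P → Ω → ℝ) (t : ℝ) (γ : Finset P) :
    ({ω | (∀ p ∈ γ, t ≤ φ p ω) ∧ (∀ u ∈ γ, ∀ v, adj u v → v ∉ γ → φ v ω < t)} ⊆ ⋂ p ∈ γ, {ω | t ≤ φ p ω}) ∧
    (∀ u ∈ γ, ∀ v ∉ γ, adj u v →
      {ω | (∀ p ∈ γ, t ≤ φ p ω) ∧ (∀ u ∈ γ, ∀ v, adj u v → v ∉ γ → φ v ω < t)} ∩ {ω | t ≤ φ v ω} = ∅) := by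
  refine ⟨fun ω hω => Set.mem_iInter₂.2 fun p hp => hω.1 p hp, fun u hu v hv huv => ?_⟩
  rw [Set.eq_empty_iff_forall_notMem]
  rintro ω ⟨hω, hωv⟩
  exact absurd hωv (not_le.2 (hω.2 u hu v huv hv))

end Combinatorics

/-! ## §2 Measure theory: exclusive supported events inherit the cell product law for ALL sub-families -/

section Exclusive

variable {Ω : Type*} [MeasurableSpace Ω] (μ : Measure Ω) [IsFiniteMeasure μ]
variable {P κ : Type*} [DecidableEq P]

/-- **Product law for exclusive supported events.**  Let the cell events obey `μ(⋂_{p∈A} Bad p) ≤ ∏_{p∈A} δ p` for every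
finite `A` (`δ ≥ 0`).  Let polymer events `E γ` (`γ ∈ S`, supports `supp γ`) satisfy `E γ ⊆ ⋂_{p∈supp γ} Bad p` and be
EXCLUSIVE on support-overlaps: `γ ≠ γ'`, `supp γ ∩ supp γ' ≠ ∅` ⇒ `E γ ∩ E γ' = ∅`.  Then for EVERY `A ⊆ S`,
`μ(⋂_{γ∈A} E γ) ≤ ∏_{γ∈A} ∏_{p∈supp γ} δ p`.  Proof: if the supports over `A` are pairwise disjoint, the intersection lies
in `⋂_{p ∈ ⋃ supp} Bad p` and `∏_{⋃ supp} δ = ∏_γ ∏_{supp γ} δ`; otherwise it is empty. [folklore] -/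
theorem productLaw_of_exclusive (Bad : P → Set Ω) (δ : P → ℝ) (hδ : ∀ p, 0 ≤ δ p)
    (hPL : ∀ A : Finset P, μ.real (⋂ p ∈ A, Bad p) ≤ ∏ p ∈ A, δ p)
    (S : Finset κ) (supp : κ → Finset P) (E : κ → Set Ω)
    (hE1 : ∀ γ ∈ S, E γ ⊆ ⋂ p ∈ supp γ, Bad p)
    (hex : ∀ γ ∈ S, ∀ γ' ∈ S, γ ≠ γ' → ¬ Disjoint (supp γ) (supp γ') → E γ ∩ E γ' = ∅) :
    ∀ A, A ⊆ S → μ.real (⋂ γ ∈ A, E γ) ≤ ∏ γ ∈ A, ∏ p ∈ supp γ, δ p := by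
  intro A hA
  by_cases hdisj : (A : Set κ).PairwiseDisjoint supp
  · -- compatible family: reduce to the cell law on the union of the supports
    have hsub : (⋂ γ ∈ A, E γ) ⊆ ⋂ p ∈ A.biUnion supp, Bad p := by
      intro ω hω
      refine Set.mem_iInter₂.2 fun p hp => ?_
      obtain ⟨γ, hγ, hpγ⟩ := Finset.mem_biUnion.1 hp
      exact Set.mem_iInter₂.1 (hE1 γ (hA hγ) (Set.mem_iInter₂.1 hω γ hγ)) p hpγ
    calc μ.real (⋂ γ ∈ A, E γ) ≤ μ.real (⋂ p ∈ A.biUnion supp, Bad p) := measureReal_mono hsub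
      _ ≤ ∏ p ∈ A.biUnion supp, δ p := hPL _
      _ = ∏ γ ∈ A, ∏ p ∈ supp γ, δ p := Finset.prod_biUnion hdisj
  · -- incompatible family: two distinct members with overlapping supports ⇒ empty intersection
    have h' : ∃ γ ∈ A, ∃ γ' ∈ A, γ ≠ γ' ∧ ¬ Disjoint (supp γ) (supp γ') := by
      by_contra hcon
      push Not at hcon
      exact hdisj fun γ hγ γ' hγ' hne => hcon γ hγ γ' hγ' hne
    obtain ⟨γ, hγ, γ', hγ', hne, hov⟩ := h'
    have hempty : (⋂ γ ∈ A, E γ) ⊆ (∅ : Set Ω) := by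
      rw [← hex γ (hA hγ) γ' (hA hγ') hne hov]
      exact fun ω hω => ⟨Set.mem_iInter₂.1 hω γ hγ, Set.mem_iInter₂.1 hω γ' hγ'⟩
    calc μ.real (⋂ γ ∈ A, E γ) ≤ μ.real (∅ : Set Ω) := measureReal_mono hempty
      _ = 0 := measureReal_empty
      _ ≤ ∏ γ ∈ A, ∏ p ∈ supp γ, δ p :=
          Finset.prod_nonneg fun γ _ => Finset.prod_nonneg fun p _ => hδ p

/-- **Product law for COMPONENT events** (supports = the polymers themselves): cell product law + cut-connected polymers
+ (E1)/(E2) ⇒ `μ(⋂_{γ∈A} E γ) ≤ ∏_{γ∈A} ∏_{p∈γ} δ p` for every `A ⊆ S` — hypothesis (PL)(iv) of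
`integral_exp_sum_indicator_le_prod` for the large-field-region gas. [folklore] -/
theorem productLaw_of_components (adj : P → P → Prop) (Bad : P → Set Ω) (δ : P → ℝ) (hδ : ∀ p, 0 ≤ δ p)
    (hPL : ∀ A : Finset P, μ.real (⋂ p ∈ A, Bad p) ≤ ∏ p ∈ A, δ p)
    (S : Finset (Finset P)) (E : Finset P → Set Ω)
    (hconn : ∀ γ ∈ S, ∀ A ⊆ γ, A.Nonempty → (γ \ A).Nonempty → ∃ u ∈ A, ∃ v ∈ γ \ A, adj u v)
    (hE1 : ∀ γ ∈ S, E γ ⊆ ⋂ p ∈ γ, Bad p)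
    (hE2 : ∀ γ ∈ S, ∀ u ∈ γ, ∀ v ∉ γ, adj u v → E γ ∩ Bad v = ∅) :
    ∀ A, A ⊆ S → μ.real (⋂ γ ∈ A, E γ) ≤ ∏ γ ∈ A, ∏ p ∈ γ, δ p :=
  productLaw_of_exclusive μ Bad δ hδ hPL S id E hE1 fun γ hγ γ' hγ' hne hov =>
    inter_eq_empty_of_cutConnected adj Bad E (hconn γ hγ) (hconn γ' hγ') (hE1 γ hγ) (hE1 γ' hγ')
      (hE2 γ hγ) (hE2 γ' hγ') hne hov

end Exclusive


/-! ## §3 The Wilson state on every odd torus: the scale-zero large-field COMPONENT gas obeys the product law -/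

section Torus

open Summit.QuantumFields.YangMills.Cruxes.OSLegsFromFemtoAndGap.DlrCollarTransfer

variable {G : Type} [Group G] [TopologicalSpace G] [IsTopologicalGroup G] [CompactSpace G]
  [MeasurableSpace G] [BorelSpace G]

/-- **The ε-large components of the Wilson state on an odd four-torus form a polymer gas with the product law for ALL
sub-families.**  For every lattice representation `r` (constants `K₀, D₁` of p530009 `productLaw_largePlaquettes`,
`δ(β,ε) = exp(−βε/m + (K₀ + D₁ log β)/m)`, `m = #orientations`): on every odd torus `(ℤ/M)⁴`, `M ≥ 3`, at `β ≥ 1`, for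
every threshold `ε`, EVERY adjacency relation `adj` on torus plaquettes and every family `S` of `adj`-cut-connected polymers,
the component events `E_γ = {U | every p ∈ γ has φ_p(U) ≥ ε, every adj-neighbour of γ outside γ has φ < ε}` satisfy
`μ_{M,β}(⋂_{γ∈A} E_γ) ≤ ∏_{γ∈A} δ(β,ε)^{#γ}` for every `A ⊆ S` — clause (PL)(iv) for the large-field REGION gas at scale
zero, weights of Bałaban's kind `e^{−(βε/m − O(log β))·|γ|}`.  Proof: §2 `productLaw_of_components` over p530009.
[folklore: Fröhlich–Israel–Lieb–Simon (1978) §5 for the cell law] -/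
theorem productLaw_largePlaquetteComponents (r : LatticeRep G) :
    ∃ K₀ : ℝ, ∃ D₁ : ℕ, ∀ {M : ℕ} [NeZero M], Odd M → 3 ≤ M → ∀ β : ℝ, 1 ≤ β → ∀ (ε : ℝ)
      (adj : Plaquette 4 M → Plaquette 4 M → Prop) (S : Finset (Finset (Plaquette 4 M))),
      (∀ γ ∈ S, ∀ A ⊆ γ, A.Nonempty → (γ \ A).Nonempty → ∃ u ∈ A, ∃ v ∈ γ \ A, adj u v) →
      ∀ A, A ⊆ S →
        (wilsonMeasure (d := 4) (L := M) r.ρ β).real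
            (⋂ γ ∈ A, {U | (∀ p ∈ γ, ε ≤ plaquetteCost r.ρ U p) ∧
              (∀ u ∈ γ, ∀ v, adj u v → v ∉ γ → plaquetteCost r.ρ U v < ε)}) ≤
          ∏ γ ∈ A, Real.exp (-(β * ε) / Fintype.card (Orient 4) +
            (K₀ + D₁ * Real.log β) / Fintype.card (Orient 4)) ^ γ.card := by
  classical
  obtain ⟨K₀, D₁, h⟩ := productLaw_largePlaquettes (G := G) r
  refine ⟨K₀, D₁, ?_⟩
  intro M _ hM hM3 β hβ ε adj S hconn A hA
  haveI : SecondCountableTopology G :=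
    (r.continuous.isClosedEmbedding r.injective).isEmbedding.secondCountableTopology
  haveI := isProbabilityMeasure_wilsonMeasure (d := 4) (L := M) r.ρ r.continuous β
  set δ : ℝ := Real.exp (-(β * ε) / Fintype.card (Orient 4) + (K₀ + D₁ * Real.log β) / Fintype.card (Orient 4))
    with hδ
  have hspec := fun γ : Finset (Plaquette 4 M) =>
    componentEvent_spec (Ω := GaugeConfig 4 M G) adj (fun p U => plaquetteCost r.ρ U p) ε γ
  have key := productLaw_of_components (wilsonMeasure (d := 4) (L := M) r.ρ β) adj
    (fun p => {U : GaugeConfig 4 M G | ε ≤ plaquetteCost r.ρ U p}) (fun _ => δ) (fun _ => (Real.exp_pos _).le)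
    (fun B => h hM hM3 β hβ ε B) S
    (fun γ => {U | (∀ p ∈ γ, ε ≤ plaquetteCost r.ρ U p) ∧ (∀ u ∈ γ, ∀ v, adj u v → v ∉ γ → plaquetteCost r.ρ U v < ε)})
    hconn (fun γ _ => (hspec γ).1) (fun γ _ => (hspec γ).2) A hA
  simpa only [Finset.prod_const] using key

omit [IsTopologicalGroup G] [CompactSpace G] [MeasurableSpace G] [BorelSpace G] in
/-- The lifted component event of a polymer `γ` of `ℤ⁴`-plaquettes with boundary collar `∂γ`, read on the periodic lift
of a torus configuration, is the torus event «all projected plaquettes of `γ` are ε-large and all projected plaquettes of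
`∂γ` are not». [folklore] -/
theorem preimage_componentEventZd_torusLift (r : LatticeRep G) (M : ℕ) (ε : ℝ) (γ bd : Finset (ZdPlaquette 4)) :
    (torusLift M) ⁻¹'
        {η : LGConfig 4 G | (∀ q ∈ γ, ε ≤ (r.N : ℝ) - plaquetteObs r.ρ q.1 q.2.1.1 q.2.1.2 η) ∧
          (∀ v ∈ bd, (r.N : ℝ) - plaquetteObs r.ρ v.1 v.2.1.1 v.2.1.2 η < ε)} =
      (⋂ q ∈ γ, {U : GaugeConfig 4 M G | ε ≤ plaquetteCost r.ρ U (Torus.proj M q.1, q.2)}) ∩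
        ⋂ v ∈ bd, {U : GaugeConfig 4 M G | plaquetteCost r.ρ U (Torus.proj M v.1, v.2) < ε} := by
  have hval : ∀ (q : ZdPlaquette 4) (V : GaugeConfig 4 M G),
      (r.N : ℝ) - plaquetteObs r.ρ q.1 q.2.1.1 q.2.1.2 (torusLift M V) = plaquetteCost r.ρ V (Torus.proj M q.1, q.2) :=
    fun q V => by
      rw [plaquetteObs, FreeEnergy.plaquetteHolonomyZd_torusLift]
      rfl
  ext V
  simp only [Set.mem_preimage, Set.mem_setOf_eq, hval, Set.mem_inter_iff, Set.mem_iInter]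

/-- **Clause (iv) of (PL) for the scale-zero COMPONENT gas, in the route's lifted vocabulary, on every odd torus.**  For
every lattice representation `r` (constants `K₀, D₁` as above): for `1 ≤ L`, `β ≥ 1`, a threshold `ε`, ANY adjacency
`adj` on the plaquettes of `ℤ⁴`, and a finite family `S` of polymers `γ` (finite sets of plaquettes based in the
fundamental box `[−L, L]⁴`) that are `adj`-cut-connected and come with boundary collars `∂γ ⊇ {v ∉ γ | ∃ u ∈ γ, adj u v}`,
the lifted component events `E_γ = {η | ∀ q ∈ γ, ε ≤ N − Re tr r(η_{∂q}); ∀ v ∈ ∂γ, N − Re tr r(η_{∂v}) < ε}` satisfy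
`torusE_{2L+1,β}(∏_{γ∈A} 1_{E_γ}) ≤ ∏_{γ∈A} δ(β,ε)^{#γ}` for EVERY `A ⊆ S` — incompatible families included (their
contribution vanishes).  Proof: §1 at the level of `ℤ⁴` (exclusivity), injectivity of the projection on the box, §2 on
the torus over p530009. [folklore] -/
theorem torusE_prod_indicator_largeComponentZd_le (r : LatticeRep G) :
    ∃ K₀ : ℝ, ∃ D₁ : ℕ, ∀ (L : ℕ), 1 ≤ L → ∀ β : ℝ, 1 ≤ β → ∀ (ε : ℝ)
      (adj : ZdPlaquette 4 → ZdPlaquette 4 → Prop) (S : Finset (Finset (ZdPlaquette 4)))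
      (bd : Finset (ZdPlaquette 4) → Finset (ZdPlaquette 4)),
      (∀ γ ∈ S, ∀ q ∈ γ, q.1 ∈ box 4 L) →
      (∀ γ ∈ S, ∀ A ⊆ γ, A.Nonempty → (γ \ A).Nonempty → ∃ u ∈ A, ∃ v ∈ γ \ A, adj u v) →
      (∀ γ ∈ S, ∀ u ∈ γ, ∀ v, adj u v → v ∉ γ → v ∈ bd γ) →
      ∀ A, A ⊆ S →
        torusE G r β L (fun U => ∏ γ ∈ A,
          {η : LGConfig 4 G | (∀ q ∈ γ, ε ≤ (r.N : ℝ) - plaquetteObs r.ρ q.1 q.2.1.1 q.2.1.2 η) ∧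
            (∀ v ∈ bd γ, (r.N : ℝ) - plaquetteObs r.ρ v.1 v.2.1.1 v.2.1.2 η < ε)}.indicator
            (fun _ => (1 : ℝ)) U) ≤
          ∏ γ ∈ A, Real.exp (-(β * ε) / Fintype.card (Orient 4) +
            (K₀ + D₁ * Real.log β) / Fintype.card (Orient 4)) ^ γ.card := by
  classical
  obtain ⟨K₀, D₁, h⟩ := productLaw_largePlaquettes (G := G) r
  refine ⟨K₀, D₁, ?_⟩
  intro L hL β hβ ε adj S bd hbox hconn hbd A hA
  haveI : SecondCountableTopology G :=
    (r.continuous.isClosedEmbedding r.injective).isEmbedding.secondCountableTopology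
  haveI := isProbabilityMeasure_wilsonMeasure (d := 4) (L := 2 * L + 1) r.ρ r.continuous β
  set δ : ℝ := Real.exp (-(β * ε) / Fintype.card (Orient 4) + (K₀ + D₁ * Real.log β) / Fintype.card (Orient 4))
    with hδ
  set π : ZdPlaquette 4 → Plaquette 4 (2 * L + 1) := fun q => (Torus.proj (2 * L + 1) q.1, q.2) with hπ
  -- the `ℤ⁴`-level data
  set φ : ZdPlaquette 4 → LGConfig 4 G → ℝ := fun q η => (r.N : ℝ) - plaquetteObs r.ρ q.1 q.2.1.1 q.2.1.2 η with hφ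
  set EZ : Finset (ZdPlaquette 4) → Set (LGConfig 4 G) :=
    fun γ => {η | (∀ q ∈ γ, ε ≤ φ q η) ∧ (∀ v ∈ bd γ, φ v η < ε)} with hEZ
  -- exclusivity at the level of `ℤ⁴` (§1 with the canonical component events, then shrink to the collar form)
  have hexZ : ∀ γ ∈ S, ∀ γ' ∈ S, γ ≠ γ' → ¬ Disjoint γ γ' → EZ γ ∩ EZ γ' = ∅ := by
    intro γ hγ γ' hγ' hne hov
    have hE1 : ∀ γ ∈ S, EZ γ ⊆ ⋂ p ∈ γ, {η | ε ≤ φ p η} := fun γ _ η hη =>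
      Set.mem_iInter₂.2 fun p hp => hη.1 p hp
    have hE2 : ∀ γ ∈ S, ∀ u ∈ γ, ∀ v ∉ γ, adj u v → EZ γ ∩ {η | ε ≤ φ v η} = ∅ := by
      intro γ hγ u hu v hv huv
      rw [Set.eq_empty_iff_forall_notMem]
      rintro η ⟨hη, hηv⟩
      exact absurd hηv (not_le.2 (hη.2 v (hbd γ hγ u hu v huv hv)))
    exact inter_eq_empty_of_cutConnected adj (fun p => {η | ε ≤ φ p η}) EZ (hconn γ hγ) (hconn γ' hγ')
      (hE1 γ hγ) (hE1 γ' hγ') (hE2 γ hγ) (hE2 γ' hγ') hne hov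
  -- the torus-level data
  set E' : Finset (ZdPlaquette 4) → Set (GaugeConfig 4 (2 * L + 1) G) := fun γ => (torusLift (2 * L + 1)) ⁻¹' (EZ γ)
    with hE'def
  have hE'eq : ∀ γ, E' γ = (⋂ q ∈ γ, {U : GaugeConfig 4 (2 * L + 1) G | ε ≤ plaquetteCost r.ρ U (π q)}) ∩
      ⋂ v ∈ bd γ, {U : GaugeConfig 4 (2 * L + 1) G | plaquetteCost r.ρ U (π v) < ε} := fun γ =>
    preimage_componentEventZd_torusLift r (2 * L + 1) ε γ (bd γ)
  have hE'm : ∀ γ, MeasurableSet (E' γ) := fun γ => by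
    rw [hE'eq]
    refine (Finset.measurableSet_biInter _ fun q _ => ?_).inter (Finset.measurableSet_biInter _ fun v _ => ?_)
    · exact measurableSet_le measurable_const (measurable_plaquetteCost r.ρ r.continuous _)
    · exact measurableSet_lt (measurable_plaquetteCost r.ρ r.continuous _) measurable_const
  have hπinj : ∀ γ ∈ S, ∀ γ' ∈ S, ∀ q ∈ γ, ∀ q' ∈ γ', π q = π q' → q = q' := by
    intro γ hγ γ' hγ' q hq q' hq' hqq'
    simp only [hπ, Prod.mk.injEq] at hqq'
    exact Prod.ext (torusProj_injOn_box_of_lt (d := 4) (n := L) (L := 2 * L + 1) (by omega) (hbox γ hγ q hq)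
      (hbox γ' hγ' q' hq') hqq'.1) hqq'.2
  -- (E1) on the torus
  have hE1' : ∀ γ ∈ S, E' γ ⊆ ⋂ p ∈ γ.image π, {U : GaugeConfig 4 (2 * L + 1) G | ε ≤ plaquetteCost r.ρ U p} := by
    intro γ _ U hU
    rw [hE'eq] at hU
    refine Set.mem_iInter₂.2 fun p hp => ?_
    obtain ⟨q, hq, rfl⟩ := Finset.mem_image.1 hp
    exact Set.mem_iInter₂.1 hU.1 q hq
  -- exclusivity on the torus
  have hex' : ∀ γ ∈ S, ∀ γ' ∈ S, γ ≠ γ' → ¬ Disjoint (γ.image π) (γ'.image π) → E' γ ∩ E' γ' = ∅ := by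
    intro γ hγ γ' hγ' hne hov
    have hovZ : ¬ Disjoint γ γ' := by
      obtain ⟨p, hp, hp'⟩ := Finset.not_disjoint_iff.1 hov
      obtain ⟨q, hq, hqp⟩ := Finset.mem_image.1 hp
      obtain ⟨q', hq', hq'p⟩ := Finset.mem_image.1 hp'
      have hqq' : q = q' := hπinj γ hγ γ' hγ' q hq q' hq' (hqp.trans hq'p.symm)
      exact Finset.not_disjoint_iff.2 ⟨q, hq, hqq' ▸ hq'⟩
    have hZ := hexZ γ hγ γ' hγ' hne hovZ
    rw [hE'def, ← Set.preimage_inter, hZ, Set.preimage_empty]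
  have key := productLaw_of_exclusive (wilsonMeasure (d := 4) (L := 2 * L + 1) r.ρ β)
    (fun p => {U : GaugeConfig 4 (2 * L + 1) G | ε ≤ plaquetteCost r.ρ U p}) (fun _ => δ)
    (fun _ => (Real.exp_pos _).le) (fun B => h (odd_two_mul_add_one L) (by omega) β hβ ε B) S
    (fun γ => γ.image π) E' hE1' hex' A hA
  -- read the product of indicators on the torus and assemble
  have hread : ∀ V : GaugeConfig 4 (2 * L + 1) G,
      (∏ γ ∈ A, (EZ γ).indicator (fun _ => (1 : ℝ)) (torusLift (2 * L + 1) V)) =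
        ∏ γ ∈ A, (E' γ).indicator (fun _ => (1 : ℝ)) V := fun V =>
    Finset.prod_congr rfl fun γ _ => (indicator_one_preimage (torusLift (2 * L + 1)) (EZ γ) V).symm
  have hcard : ∀ γ ∈ A, (∏ _p ∈ γ.image π, δ) = δ ^ γ.card := fun γ hγ => by
    rw [Finset.prod_const, Finset.card_image_of_injOn fun q hq q' hq' hqq' =>
      hπinj γ (hA hγ) γ (hA hγ) q hq q' hq' hqq']
  show ∫ V, (∏ γ ∈ A, (EZ γ).indicator (fun _ => (1 : ℝ)) (torusLift (2 * L + 1) V))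
      ∂(wilsonMeasure (d := 4) (L := 2 * L + 1) r.ρ β) ≤ ∏ γ ∈ A, δ ^ γ.card
  simp_rw [hread]
  rw [integral_prod_indicator_eq_measureReal _ A E' hE'm, ← Finset.prod_congr rfl hcard]
  exact key

end Torus

end Summit.QuantumFields.YangMills.Cruxes.UVSeamRec.PolymerRarity

end
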